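import Summits.QuantumFields.YangMills.Theorems.HyperbolicRegulatorHyperbolicToTorusStubChart

/-!
# `HyperbolicToTorus` — line `no_admissible_complex` v3, stub SHELL GERM (the lead's stub)

Crux `stmt-QuantumFields-15827` (`Summit.QuantumFields.YangMills.Theses.HyperbolicRegulator.HyperbolicToTorus`), route
`HyperbolicRegulator`; registered stub `stub_shellGerm` of the skeleton `Cruxes/HyperbolicToTorus/Lines/no_admissible_complex.lean`
v3 (vocabulary: `Theorems/HyperbolicRegulatorHyperbolicToTorusDefs.lean`; `StubChart.inBox_of_unitStep` reused from the
landed `…StubChart.lean`).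

**Statement.** In an admissible complex with `k ≥ 16` (`R := k/4 ≥ 4`), given charts-with-tracking at flat vertices and
opposite-neighbour rigidity of all charts, every vertex `v ∈ V` at distance exactly `R + 1` from a cone `c` lies in
`germSet E σ τ R c`.

**Proof.** `v` is flat (the other cones are `≥ k - R - 1 > R` away: axiom 6 and the triangle inequality), so `φ := cV v` is a
chart tracking walks. Track a geodesic `v ⇝ c`: positions `P i` with unit steps and `‖P i‖₁ ≤ i`; chart paths give
`dist v (φ a) ≤ ‖a‖₁`, so `‖P R‖₁ = R`. If `P R` is a TIP `R•d` (`d` a unit vector) then `P (R-1) = (R-1)•d`, and going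
straight from the germ `(φ (R•d), φ ((R-1)•d))` — `OppRigid` for the rotated chart `φ ∘ rotBy d` — reproduces the axis down to
`φ 0 = v` after `R - 1` steps: `v` is a tip germ. Otherwise `P R` is interior, so `c = φ b` for a lattice neighbour `b` of
`P R`; `b` is not interior (a cone never is: `Adm.degOf_chart_ne_five`), and `‖b‖₁ ≤ R` would give `dist v c ≤ R`, so
`b = R•d + s•d⊥` with `s = ±1`; then `φ ((R-1)•d + s•d⊥)` is a neighbour of `c`, going straight from `(c, ·)` along the
row reaches `φ (s•d⊥)` after `R - 1` steps, and `v = φ 0` is one of its neighbours: `v` is a side germ.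

Helpers (`StubShellGerm`): rotations transport `IsChart`; `straightIter_row`; chart distances from the centre; tip and
side memberships. Finite combinatorics (folklore); nothing is cited.
-/

set_option autoImplicit false

namespace Summit.QuantumFields.YangMills.Cruxes.HyperbolicToTorus.NoAdmissibleComplex

open Finset

namespace StubShellGerm

open SimpleGraph

section Rot
variable {d : ℤ × ℤ}

/-- Boxes are invariant under the rotation `rotBy d`, `d` a unit vector. -/
theorem inBox_rotBy (hd : d = (1, 0) ∨ d = (0, 1) ∨ d = (-1, 0) ∨ d = (0, -1)) (S : ℤ) (a : ℤ × ℤ) :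
    InBox S (rotBy d a) ↔ InBox S a := by
  rcases hd with rfl | rfl | rfl | rfl <;> simp [rotBy, InBox, abs_neg, and_comm]

/-- Unit steps are invariant under the rotation `rotBy d`, `d` a unit vector. -/
theorem unitStep_rotBy_iff (hd : d = (1, 0) ∨ d = (0, 1) ∨ d = (-1, 0) ∨ d = (0, -1)) (a b : ℤ × ℤ) :
    UnitStep (rotBy d a) (rotBy d b) ↔ UnitStep a b := by
  rcases hd with rfl | rfl | rfl | rfl <;> simp [rotBy, UnitStep, Prod.ext_iff] <;> omega

/-- `rotBy (d.1, -d.2)` (rotation by the conjugate) undoes `rotBy d`. -/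
theorem rotBy_conj_rotBy (hd : d = (1, 0) ∨ d = (0, 1) ∨ d = (-1, 0) ∨ d = (0, -1)) (a : ℤ × ℤ) :
    rotBy (d.1, -d.2) (rotBy d a) = a := by
  rcases hd with rfl | rfl | rfl | rfl <;> simp [rotBy]

/-- `rotBy d` undoes `rotBy (d.1, -d.2)`. -/
theorem rotBy_rotBy_conj (hd : d = (1, 0) ∨ d = (0, 1) ∨ d = (-1, 0) ∨ d = (0, -1)) (a : ℤ × ℤ) :
    rotBy d (rotBy (d.1, -d.2) a) = a := by
  rcases hd with rfl | rfl | rfl | rfl <;> simp [rotBy]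

/-- The rotation fixes the centre. -/
theorem rotBy_zero (d : ℤ × ℤ) : rotBy d (0, 0) = (0, 0) := by
  simp [rotBy]

/-- **A rotated chart is a chart**: `IsChart Γ R ψ → IsChart Γ R (ψ ∘ rotBy d)` for a unit vector `d`. -/
theorem isChart_comp_rotBy {Γ : SimpleGraph ℕ} {R : ℤ} {ψ : ℤ × ℤ → ℕ} (hC : IsChart Γ R ψ)
    (hd : d = (1, 0) ∨ d = (0, 1) ∨ d = (-1, 0) ∨ d = (0, -1)) : IsChart Γ R (ψ ∘ rotBy d) := by
  refine ⟨?_, ?_, ?_⟩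
  · intro a ha b hb h
    have h' : rotBy d a = rotBy d b :=
      hC.1 ((inBox_rotBy hd R a).2 ha) ((inBox_rotBy hd R b).2 hb) h
    have := congrArg (rotBy (d.1, -d.2)) h'
    rwa [rotBy_conj_rotBy hd, rotBy_conj_rotBy hd] at this
  · intro a b ha hb hab
    exact hC.2.1 _ _ ((inBox_rotBy hd R a).2 ha) ((inBox_rotBy hd R b).2 hb) ((unitStep_rotBy_iff hd a b).2 hab)
  · intro a ha w hw
    obtain ⟨b', hb', rfl⟩ := hC.2.2 _ ((inBox_rotBy hd (R - 1) a).2 ha) w hw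
    refine ⟨rotBy (d.1, -d.2) b', ?_, ?_⟩
    · rw [← unitStep_rotBy_iff hd, rotBy_rotBy_conj hd]
      exact hb'
    · simp only [Function.comp_apply]
      rw [rotBy_rotBy_conj hd]
end Rot

section Straight
variable {Γ : SimpleGraph ℕ} {R : ℤ} {ψ : ℤ × ℤ → ℕ}

/-- If the opposite neighbour is unique, `opp` returns it. -/
theorem opp_eq {a b u₀ : ℕ} (h : ∀ u, IsOpposite Γ a b u ↔ u = u₀) : opp Γ a b = u₀ := by
  have hex : ∃ u, IsOpposite Γ a b u := ⟨u₀, (h u₀).2 rfl⟩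
  unfold opp
  rw [dif_pos hex]
  exact (h _).1 hex.choose_spec

/-- **Going straight reproduces a row of the chart.** Starting from the pair `(ψ (m₀+1, s), ψ (m₀, s))`, `i` straight
steps end at `(ψ (m₀-i+1, s), ψ (m₀-i, s))`, as long as opposite-neighbour rigidity applies along the way. -/
theorem straightIter_row (hO : OppRigid Γ R ψ) (m₀ s : ℤ) (hm : m₀ ≤ R - 1) (hs : |s| ≤ R - 2) :
    ∀ i : ℕ, (i : ℤ) ≤ m₀ + R - 2 →
      straightIter Γ i (ψ (m₀ + 1, s), ψ (m₀, s)) = (ψ (m₀ - i + 1, s), ψ (m₀ - i, s)) := by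
  intro i
  induction i with
  | zero => intro _; simp [straightIter]
  | succ i ih =>
    intro hi
    have hi' : (i : ℤ) ≤ m₀ + R - 2 := by push_cast at hi; omega
    rw [straightIter, ih hi']
    simp only
    have key := hO (m₀ - i, s) (by push_cast at hi; omega) (by omega) hs
    rw [opp_eq key]
    push_cast
    ring_nf
end Straight

section Dist
variable {Γ : SimpleGraph ℕ} {R : ℤ} {ψ : ℤ × ℤ → ℕ}

/-- Along a row of the box, to the right: reachable, distance at most the number of steps. -/
theorem row_right (hC : IsChart Γ R ψ) (s t : ℤ) (hs : |s| ≤ R) (ht : |t| ≤ R) :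
    ∀ n : ℕ, |s + n| ≤ R → Γ.Reachable (ψ (s, t)) (ψ (s + n, t)) ∧ Γ.dist (ψ (s, t)) (ψ (s + n, t)) ≤ n := by
  intro n
  induction n with
  | zero => intro _; simp
  | succ n ih =>
    intro hn
    have hn' : |s + n| ≤ R := by
      rw [abs_le] at hs hn ⊢; push_cast at hn; constructor <;> omega
    obtain ⟨hr, hd⟩ := ih hn'
    have hadj : Γ.Adj (ψ (s + n, t)) (ψ (s + (n + 1 : ℕ), t)) := by
      refine hC.2.1 _ _ ⟨hn', ht⟩ ⟨hn, ht⟩ (Or.inl ?_)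
      push_cast; ring_nf
    refine ⟨hr.trans hadj.reachable, ?_⟩
    calc Γ.dist (ψ (s, t)) (ψ (s + (n + 1 : ℕ), t))
        ≤ Γ.dist (ψ (s, t)) (ψ (s + n, t)) + Γ.dist (ψ (s + n, t)) (ψ (s + (n + 1 : ℕ), t)) :=
          hadj.reachable.dist_triangle_right _
      _ ≤ n + 1 := by rw [SimpleGraph.dist_eq_one_iff_adj.2 hadj]; omega

/-- Along a column of the box, upwards: reachable, distance at most the number of steps. -/
theorem col_up (hC : IsChart Γ R ψ) (s t : ℤ) (hs : |s| ≤ R) (ht : |t| ≤ R) :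
    ∀ n : ℕ, |t + n| ≤ R → Γ.Reachable (ψ (s, t)) (ψ (s, t + n)) ∧ Γ.dist (ψ (s, t)) (ψ (s, t + n)) ≤ n := by
  intro n
  induction n with
  | zero => intro _; simp
  | succ n ih =>
    intro hn
    have hn' : |t + n| ≤ R := by
      rw [abs_le] at ht hn ⊢; push_cast at hn; constructor <;> omega
    obtain ⟨hr, hd⟩ := ih hn'
    have hadj : Γ.Adj (ψ (s, t + n)) (ψ (s, t + (n + 1 : ℕ))) := by
      refine hC.2.1 _ _ ⟨hs, hn'⟩ ⟨hs, hn⟩ (Or.inr (Or.inr (Or.inl ?_)))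
      push_cast; ring_nf
    refine ⟨hr.trans hadj.reachable, ?_⟩
    calc Γ.dist (ψ (s, t)) (ψ (s, t + (n + 1 : ℕ)))
        ≤ Γ.dist (ψ (s, t)) (ψ (s, t + n)) + Γ.dist (ψ (s, t + n)) (ψ (s, t + (n + 1 : ℕ))) :=
          hadj.reachable.dist_triangle_right _
      _ ≤ n + 1 := by rw [SimpleGraph.dist_eq_one_iff_adj.2 hadj]; omega

/-- Along a row, both directions: from `(0, t)` to `(s, t)`, distance `≤ |s|`. -/
theorem row_dist (hC : IsChart Γ R ψ) (s t : ℤ) (hs : |s| ≤ R) (ht : |t| ≤ R) :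
    Γ.Reachable (ψ (0, t)) (ψ (s, t)) ∧ Γ.dist (ψ (0, t)) (ψ (s, t)) ≤ s.natAbs := by
  have h0 : |(0 : ℤ)| ≤ R := by rw [abs_le] at hs ⊢; omega
  rcases Int.natAbs_eq s with h | h
  · obtain ⟨hr, hd⟩ := row_right hC 0 t h0 ht s.natAbs (by rw [zero_add, ← h]; exact hs)
    rw [zero_add, ← h] at hr hd
    exact ⟨hr, hd⟩
  · obtain ⟨hr, hd⟩ := row_right hC s t hs ht s.natAbs (by rw [abs_le] at hs ⊢; omega)
    have e : s + (s.natAbs : ℤ) = 0 := by omega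
    rw [e] at hr hd
    rw [SimpleGraph.dist_comm] at hd
    exact ⟨hr.symm, hd⟩

/-- Along a column, both directions: from `(s, 0)` to `(s, t)`, distance `≤ |t|`. -/
theorem col_dist (hC : IsChart Γ R ψ) (s t : ℤ) (hs : |s| ≤ R) (ht : |t| ≤ R) :
    Γ.Reachable (ψ (s, 0)) (ψ (s, t)) ∧ Γ.dist (ψ (s, 0)) (ψ (s, t)) ≤ t.natAbs := by
  have h0 : |(0 : ℤ)| ≤ R := by rw [abs_le] at ht ⊢; omega
  rcases Int.natAbs_eq t with h | h
  · obtain ⟨hr, hd⟩ := col_up hC s 0 hs h0 t.natAbs (by rw [zero_add, ← h]; exact ht)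
    rw [zero_add, ← h] at hr hd
    exact ⟨hr, hd⟩
  · obtain ⟨hr, hd⟩ := col_up hC s t hs ht t.natAbs (by rw [abs_le] at ht ⊢; omega)
    have e : t + (t.natAbs : ℤ) = 0 := by omega
    rw [e] at hr hd
    rw [SimpleGraph.dist_comm] at hd
    exact ⟨hr.symm, hd⟩

/-- **Chart paths bound distances from the centre**: `dist (ψ 0) (ψ a) ≤ ‖a‖₁` for `a` in the box. -/
theorem dist_center_le (hC : IsChart Γ R ψ) (a : ℤ × ℤ) (ha : InBox R a) :
    Γ.Reachable (ψ (0, 0)) (ψ a) ∧ Γ.dist (ψ (0, 0)) (ψ a) ≤ a.1.natAbs + a.2.natAbs := by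
  have h0 : |(0 : ℤ)| ≤ R := by have := ha.1; rw [abs_le] at this ⊢; omega
  obtain ⟨hr1, hd1⟩ := row_dist hC a.1 0 ha.1 h0
  obtain ⟨hr2, hd2⟩ := col_dist hC a.1 a.2 ha.1 ha.2
  refine ⟨hr1.trans hr2, ?_⟩
  calc Γ.dist (ψ (0, 0)) (ψ a) = Γ.dist (ψ (0, 0)) (ψ (a.1, a.2)) := rfl
    _ ≤ Γ.dist (ψ (0, 0)) (ψ (a.1, 0)) + Γ.dist (ψ (a.1, 0)) (ψ (a.1, a.2)) := hr1.dist_triangle_left _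
    _ ≤ a.1.natAbs + a.2.natAbs := Nat.add_le_add hd1 hd2
end Dist

section Germs
variable {E : Finset ℕ} {σ τ : ℕ → ℕ} {R : ℤ} {ψ : ℤ × ℤ → ℕ}

/-- **Tip germ.** If the cone `c` is adjacent to the tip `ψ (R, 0)` of a rigid chart and the tip to `ψ (R-1, 0)`, then
the centre `ψ (0,0)` is re-grown from the germ `(ψ (R,0), ψ (R-1,0))` by `R - 1` straight steps. -/
theorem tip_mem (hO : OppRigid (graphOf E σ τ) R ψ) (Rn : ℕ) (hRn : (Rn : ℤ) = R) (hR : 2 ≤ R) {c : ℕ}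
    (hcn : (graphOf E σ τ).Adj c (ψ (R, 0))) (hny : (graphOf E σ τ).Adj (ψ (R, 0)) (ψ (R - 1, 0))) :
    ψ (0, 0) ∈ germSet E σ τ Rn c := by
  classical
  have h0 : |(0 : ℤ)| ≤ R - 2 := by rw [abs_le]; omega
  have key := straightIter_row hO (R - 1) 0 le_rfl h0 (Rn - 1) (by omega)
  have e1 : R - 1 + 1 = R := by ring
  have e2 : R - 1 - ((Rn - 1 : ℕ) : ℤ) = 0 := by omega
  rw [e1, e2, zero_add] at key
  refine Finset.mem_union_left _ (Finset.mem_biUnion.2 ⟨ψ (R, 0), mem_nbrs_of_adj hcn, ?_⟩)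
  exact Finset.mem_image.2 ⟨ψ (R - 1, 0), mem_nbrs_of_adj hny, by rw [key]⟩

/-- **Side germ.** If the cone is the chart point `c = ψ (R, s)`, `s = ±1`, of a rigid chart of radius `R ≥ 3`, then the
centre `ψ (0,0)` is a neighbour of the vertex `ψ (0, s)` reached from the germ `(c, ψ (R-1, s))` by `R - 1` straight
steps. -/
theorem side_mem (hC : IsChart (graphOf E σ τ) R ψ) (hO : OppRigid (graphOf E σ τ) R ψ) (Rn : ℕ)
    (hRn : (Rn : ℤ) = R) (hR : 3 ≤ R) {s : ℤ} (hs : s = 1 ∨ s = -1) {c : ℕ} (hc : c = ψ (R, s)) :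
    ψ (0, 0) ∈ germSet E σ τ Rn c := by
  classical
  have hsR : |s| ≤ R - 2 := by rw [abs_le]; omega
  have hs' : |s| ≤ R := by rw [abs_le]; omega
  have hRR : |R| ≤ R := by rw [abs_le]; omega
  have hR1 : |R - 1| ≤ R := by rw [abs_le]; omega
  have h0 : |(0 : ℤ)| ≤ R := by rw [abs_le]; omega
  have hadj : (graphOf E σ τ).Adj c (ψ (R - 1, s)) := by
    rw [hc]
    exact hC.2.1 _ _ ⟨hRR, hs'⟩ ⟨hR1, hs'⟩ (Or.inr (Or.inl rfl))
  have key := straightIter_row hO (R - 1) s le_rfl hsR (Rn - 1) (by omega)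
  have e1 : R - 1 + 1 = R := by ring
  have e2 : R - 1 - ((Rn - 1 : ℕ) : ℤ) = 0 := by omega
  rw [e1, e2, zero_add, ← hc] at key
  refine Finset.mem_union_right _ (Finset.mem_biUnion.2 ⟨ψ (R - 1, s), mem_nbrs_of_adj hadj, ?_⟩)
  rw [key]
  refine mem_nbrs_of_adj (hC.2.1 _ _ ⟨h0, hs'⟩ ⟨h0, h0⟩ ?_)
  rcases hs with rfl | rfl
  · exact Or.inr (Or.inr (Or.inr (by simp)))
  · exact Or.inr (Or.inr (Or.inl (by simp)))
end Germs

section Lattice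

/-- A unit step changes the `ℓ¹`-norm by at most one. -/
theorem natAbs_le_of_unitStep {a b : ℤ × ℤ} (h : UnitStep a b) :
    b.1.natAbs + b.2.natAbs ≤ a.1.natAbs + a.2.natAbs + 1 := by
  rcases h with rfl | rfl | rfl | rfl <;> simp <;> omega

/-- The point before a tip on a tracked geodesic: the only lattice neighbour of `rotBy d (R, 0)` of `ℓ¹`-norm `≤ R - 1`
is `rotBy d (R - 1, 0)`. -/
theorem eq_pretip {d : ℤ × ℤ} (hd : d = (1, 0) ∨ d = (0, 1) ∨ d = (-1, 0) ∨ d = (0, -1)) {R : ℤ} (hR : 1 ≤ R)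
    {b : ℤ × ℤ} (h : UnitStep b (rotBy d (R, 0))) (hb : (b.1.natAbs : ℤ) + b.2.natAbs ≤ R - 1) :
    b = rotBy d (R - 1, 0) := by
  rcases hd with rfl | rfl | rfl | rfl <;> simp [rotBy, UnitStep, Prod.ext_iff] at h ⊢ <;> omega

/-- A tip: a box point of `ℓ¹`-norm `R` with a coordinate of modulus `R` is `rotBy d (R, 0)` for a unit vector `d`. -/
theorem exists_tip {R : ℤ} {a : ℤ × ℤ} (ha : (a.1.natAbs : ℤ) + a.2.natAbs = R)
    (h : ¬ ((a.1.natAbs : ℤ) ≤ R - 1 ∧ (a.2.natAbs : ℤ) ≤ R - 1)) :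
    ∃ d : ℤ × ℤ, (d = (1, 0) ∨ d = (0, 1) ∨ d = (-1, 0) ∨ d = (0, -1)) ∧ a = rotBy d (R, 0) := by
  rcases le_or_gt 0 a.1 with h1 | h1 <;> rcases le_or_gt 0 a.2 with h2 | h2
  · by_cases h3 : a.2 = 0
    · exact ⟨(1, 0), Or.inl rfl, by simp [rotBy, Prod.ext_iff]; omega⟩
    · exact ⟨(0, 1), Or.inr (Or.inl rfl), by simp [rotBy, Prod.ext_iff]; omega⟩
  · by_cases h3 : a.1 = 0
    · exact ⟨(0, -1), Or.inr (Or.inr (Or.inr rfl)), by simp [rotBy, Prod.ext_iff]; omega⟩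
    · exact ⟨(1, 0), Or.inl rfl, by simp [rotBy, Prod.ext_iff]; omega⟩
  · by_cases h3 : a.2 = 0
    · exact ⟨(-1, 0), Or.inr (Or.inr (Or.inl rfl)), by simp [rotBy, Prod.ext_iff]; omega⟩
    · exact ⟨(0, 1), Or.inr (Or.inl rfl), by simp [rotBy, Prod.ext_iff]; omega⟩
  · exact ⟨(-1, 0), Or.inr (Or.inr (Or.inl rfl)), by simp [rotBy, Prod.ext_iff]; omega⟩

/-- A side point: a box point of `ℓ¹`-norm `R + 1` which is not interior is `rotBy d (R, s)` with `s = ±1`. -/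
theorem exists_side {R : ℤ} {b : ℤ × ℤ} (hbox : InBox R b) (hni : ¬ InBox (R - 1) b)
    (hb : (b.1.natAbs : ℤ) + b.2.natAbs = R + 1) :
    ∃ d : ℤ × ℤ, ∃ s : ℤ, (d = (1, 0) ∨ d = (0, 1) ∨ d = (-1, 0) ∨ d = (0, -1)) ∧ (s = 1 ∨ s = -1) ∧
      b = rotBy d (R, s) := by
  obtain ⟨hb1, hb2⟩ := hbox
  simp only [InBox, not_and_or, not_le] at hni
  rw [abs_le] at hb1 hb2
  rcases hni with h | h <;> rw [Int.abs_eq_natAbs] at h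
  · -- `|b.1| = R`
    rcases le_or_gt 0 b.1 with h1 | h1
    · refine ⟨(1, 0), b.2, Or.inl rfl, by omega, ?_⟩
      simp [rotBy, Prod.ext_iff]; omega
    · refine ⟨(-1, 0), -b.2, Or.inr (Or.inr (Or.inl rfl)), by omega, ?_⟩
      simp [rotBy, Prod.ext_iff]; omega
  · -- `|b.2| = R`
    rcases le_or_gt 0 b.2 with h2 | h2
    · refine ⟨(0, 1), -b.1, Or.inr (Or.inl rfl), by omega, ?_⟩
      simp [rotBy, Prod.ext_iff]; omega
    · refine ⟨(0, -1), b.1, Or.inr (Or.inr (Or.inr rfl)), by omega, ?_⟩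
      simp [rotBy, Prod.ext_iff]; omega
end Lattice

end StubShellGerm

open StubShellGerm in
/-- **Registered stub SHELL GERM** of `Lines/no_admissible_complex.lean` v3: in an admissible complex with `k ≥ 16`, given
charts-with-tracking at flat vertices and opposite-neighbour rigidity of all charts, every vertex at distance exactly
`k/4 + 1` from a cone `c` lies in `germSet E σ τ (k/4) c`. Proof in the module docstring: the vertex is flat, the tracked
geodesic to `c` ends at a tip (tip germ, `tip_mem` for the rotated chart) or at an interior point next to `c`, which is
then a side point of the chart (side germ, `side_mem`), a cone never being an interior chart point. -/
theorem stub_shellGerm :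
    ∀ (k j : ℕ) (V E Q : Finset ℕ) (σ τ : ℕ → ℕ) (bd : ℕ → Fin 4 → ℕ × Bool) (cV : ℕ → ℤ × ℤ → ℕ) (cE : ℕ → ℤ × ℤ → Fin 2 → ℕ × Bool), 16 ≤ k → Adm k j V E Q σ τ bd cV cE → (∀ x : ℕ, IsFlatAt k V E σ τ x → IsChart (graphOf E σ τ) ((k : ℤ) / 4) (cV x) ∧ ChartTracking (graphOf E σ τ) ((k : ℤ) / 4) (cV x)) → (∀ ψ : ℤ × ℤ → ℕ, IsChart (graphOf E σ τ) ((k : ℤ) / 4) ψ → OppRigid (graphOf E σ τ) ((k : ℤ) / 4) ψ) → ∀ c ∈ conesOf V E σ τ, ∀ v ∈ V, (graphOf E σ τ).dist v c = k / 4 + 1 → v ∈ germSet E σ τ (k / 4) c := by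
  intro k j V E Q σ τ bd cV cE hk hA hCT hOR c hc v hv hvc
  -- the vertex `v` is flat: the other cones are far by axiom 6
  have hreach : (graphOf E σ τ).Reachable v c := SimpleGraph.Reachable.of_dist_ne_zero (by omega)
  have hflat : IsFlatAt k V E σ τ v := by
    refine ⟨hv, fun c' hc' => ?_⟩
    by_cases hcc : c' = c
    · subst hcc; omega
    · have hsep := hA.separated c hc c' hc' (Ne.symm hcc)
      have htri : (graphOf E σ τ).dist c c' ≤ (graphOf E σ τ).dist c v + (graphOf E σ τ).dist v c' :=
        hreach.symm.dist_triangle_left c'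
      have hcv : (graphOf E σ τ).dist c v = k / 4 + 1 := by rw [SimpleGraph.dist_comm]; exact hvc
      omega
  obtain ⟨hC, hT⟩ := hCT v hflat
  have hcen : cV v (0, 0) = v := hA.chart_center hflat
  have hmemV : ∀ a : ℤ × ℤ, InBox ((k : ℤ) / 4) a → cV v a ∈ V := hA.chart_mem hflat
  have hcone5 : degOf E σ τ c = 5 := (Finset.mem_filter.1 hc).2
  have hne5 : ∀ a : ℤ × ℤ, InBox ((k : ℤ) / 4 - 1) a → degOf E σ τ (cV v a) ≠ 5 :=
    fun a ha => hA.degOf_chart_ne_five hflat ha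
  clear hmemV
  -- name the radius
  generalize hR : (k : ℤ) / 4 = R at hC hT hOR hne5
  generalize hRn : k / 4 = Rn at hvc ⊢
  have hRnR : (Rn : ℤ) = R := by omega
  have hRn4 : 4 ≤ Rn := by omega
  clear hk hR hRn
  -- a geodesic from `v` to `c`, tracked in the chart of `v`
  obtain ⟨W, hW⟩ := hreach.exists_walk_length_eq_dist
  rw [hvc] at hW
  obtain ⟨P, -, hstep, hpos⟩ := hT v c W hcen.symm
  obtain ⟨hgR, hlR⟩ := hpos Rn (by omega) (by omega)
  have hWc : W.getVert (Rn + 1) = c := W.getVert_of_length_le (by omega)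
  have hWR : (graphOf E σ τ).Adj (W.getVert Rn) c := by
    have := W.adj_getVert_succ (i := Rn) (by omega)
    rwa [hWc] at this
  have hd1 : (graphOf E σ τ).dist (W.getVert Rn) c = 1 := SimpleGraph.dist_eq_one_iff_adj.2 hWR
  have hge : Rn ≤ (graphOf E σ τ).dist v (W.getVert Rn) := by
    have := (W.take Rn).reachable.dist_triangle_left c
    omega
  have hboxA : InBox R (P Rn) := by
    rw [Int.abs_eq_natAbs, Int.abs_eq_natAbs] at hlR
    constructor <;> rw [Int.abs_eq_natAbs] <;> omega
  have hl1 : ((P Rn).1.natAbs : ℤ) + (P Rn).2.natAbs = R := by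
    obtain ⟨-, hle⟩ := dist_center_le hC (P Rn) hboxA
    rw [hcen, ← hgR] at hle
    rw [Int.abs_eq_natAbs, Int.abs_eq_natAbs] at hlR
    omega
  rw [hgR] at hWR
  by_cases hint : ((P Rn).1.natAbs : ℤ) ≤ R - 1 ∧ ((P Rn).2.natAbs : ℤ) ≤ R - 1
  · -- INTERIOR end point: the cone is a side point of the chart
    have hboxI : InBox (R - 1) (P Rn) := by
      constructor <;> rw [Int.abs_eq_natAbs] <;> omega
    obtain ⟨b, hab, hcb⟩ := hC.2.2 (P Rn) hboxI c hWR
    have hbR : InBox R b := StubChart.inBox_of_unitStep hboxI hab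
    have hbni : ¬ InBox (R - 1) b := fun hbi => hne5 b hbi (hcb ▸ hcone5)
    have hbl1 : (b.1.natAbs : ℤ) + b.2.natAbs = R + 1 := by
      have hup := natAbs_le_of_unitStep hab
      obtain ⟨-, hdb⟩ := dist_center_le hC b hbR
      rw [hcen, ← hcb, hvc] at hdb
      omega
    obtain ⟨d, s, hd, hs, hbds⟩ := exists_side hbR hbni hbl1
    have hCψ := isChart_comp_rotBy hC hd
    have hmem := side_mem hCψ (hOR _ hCψ) Rn hRnR (by omega) hs (c := c)
      (by simp only [Function.comp_apply, ← hbds]; exact hcb)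
    simpa [Function.comp_apply, rotBy_zero, hcen] using hmem
  · -- TIP end point: the geodesic arrives along a chart axis
    obtain ⟨d, hd, had⟩ := exists_tip hl1 hint
    have hCψ := isChart_comp_rotBy hC hd
    obtain ⟨hgR1, hlR1⟩ := hpos (Rn - 1) (by omega) (by omega)
    have hst := hstep (Rn - 1) (by omega) (by omega)
    have eRn : Rn - 1 + 1 = Rn := by omega
    rw [eRn, had] at hst
    have hpre : P (Rn - 1) = rotBy d (R - 1, 0) := by
      refine eq_pretip hd (by omega) hst ?_
      rw [Int.abs_eq_natAbs, Int.abs_eq_natAbs] at hlR1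
      omega
    have hcn : (graphOf E σ τ).Adj c ((cV v ∘ rotBy d) (R, 0)) := by
      simp only [Function.comp_apply, ← had]
      exact hWR.symm
    have hny : (graphOf E σ τ).Adj ((cV v ∘ rotBy d) (R, 0)) ((cV v ∘ rotBy d) (R - 1, 0)) := by
      simp only [Function.comp_apply, ← had, ← hpre, ← hgR, ← hgR1]
      have := W.adj_getVert_succ (i := Rn - 1) (by omega)
      rw [eRn] at this
      exact this.symm
    have hmem := tip_mem (hOR _ hCψ) Rn hRnR (by omega) hcn hny
    simpa [Function.comp_apply, rotBy_zero, hcen] using hmem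

end Summit.QuantumFields.YangMills.Cruxes.HyperbolicToTorus.NoAdmissibleComplex
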